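import Summits.CriticalPhenomena.PercolationContinuityZ3.Theorems.PercNearOneGluingNoHeavyLowerTailSahiCombTriWCompression

/-!
# `TRI_W(2) ≥ 0` on the stratum `F ∅ = G ∅ = ∅` (both monotone families vanish at the bottom index) — unconditional

Support file of the one-cut programme (crux `NoHeavyLowerTail`, stmt-CriticalPhenomena-4575; cell `prim-masterthm`, seat P5 gen 15;
report `P5-LORENTZIAN-TEST.md` §19).

`FiveUpSet.TriWIneq` (`…SahiCombTriWGeneral`) asks for `0 ≤ triW P F G` for an up-set `P` and monotone families `F, G` of up-sets indexed by a cube;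
it is OPEN for index cubes of dimension `a ≥ 2`.  At `a = 2` (index square `∅ < {a}, {b} < univ`) the pair reduction
`LatticeFiveUpSet.triW_nonneg_of_pair_nonneg` (`…SahiCombTriWCompression`) reduces it to the sign of
`triWOne c P (F ∅) (F univ) (G ∅) (G univ) + triWOne c P (F {a}) (F {b}) (G {a}) (G {b})` (outer nested pair + inner incomparable pair).
This file settles the STRATUM `F ∅ = ∅ = G ∅` (the two families vanish at the bottom index; the top values `F univ ⊇ F{a} ∪ F{b}`,
`G univ ⊇ G{a} ∪ G{b}` and the four middle up-sets are ARBITRARY):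

* **`FiveUpSet.inner_pair_le_of_bot_empty`** — for up-sets `P`, `A, B ⊆ F₁`, `C, D ⊆ G₁` of a finite cube:
  `0 ≤ triWOne c P ∅ F₁ ∅ G₁ + triWOne c P A B C D`.
  PROOF (a pointwise certificate found by a column-generation LP over the 5,184 local types and checked exactly, then kernel-checked here):
  four times the sum dominates, point by point of `P`, the following eleven instances of tree theorems — Kleitman's antipodal lemma
  (`card_inter_refl_le`) for `B ∩ D` in `P` (×3), for `A ∩ C` in `P`, for `C ∩ D` in `P ∩ B`, for `A ∩ B` in `P ∩ D`, and the five-up-set theorem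
  (`fiveUpSetIneq_holds`) for the nested pairs `(A ⊆ F₁; C ⊆ G₁)` (×3), `(B ⊆ F₁; D ⊆ G₁)`, `(A ∩ B ⊆ A; C ∩ D ⊆ C)`, `(∅ ⊆ A; D ⊆ G₁)` (×3),
  `(∅ ⊆ B; C ⊆ G₁)`, `(∅ ⊆ C; B ⊆ F₁)` (×3), `(∅ ⊆ D; A ⊆ F₁)` — and the remainder is a sum over `w ∈ P` of a function of the diamond positions of
  `w, wᶜ` in `(A, B ⊆ F₁)` and `(C, D ⊆ G₁)` that is non-negative in all `6⁴` cases (`diamond_pos`, kernel `decide`).  The certificate is not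
  symmetric under `a ↔ b`; its mirror image is another valid certificate.
* **`FiveUpSet.triW_nonneg_of_bot_empty`** — index cube with two atoms `a ≠ b`, up-set `P`, monotone families `F, G` of up-sets with
  `F ∅ = ∅` and `G ∅ = ∅`: `0 ≤ triW P F G`.  This contains the incomparable-pair core (IP-W) of report §16.3 (`F ∅ = G ∅ = ∅`, `F univ = G univ = W`)
  and is not contained in the known strata (`triW_nonneg_of_pairwise_nested`, `triW_nonneg_of_refl_subset`, `triW_self_nonneg`,
  `triW_nonneg_of_right/left_untilted`): here both inner pairs may be tilted in opposite directions and the top pair is tight.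
Report §17.9 recorded this stratum as reached by a type-level rank-certificate engine (numerical closure); the present proof is the first
human-readable / kernel-checked one, and the first use of the extended pointwise LP (atoms on `X^k × W`; all atoms needed here live on `W`).
HONEST LABEL: one new unconditional stratum of `TriWIneq` at `a = 2`; `TriWIneq` itself (general `F ∅, G ∅`) remains OPEN. [this work]
-/

namespace Summit.CriticalPhenomena.PercolationContinuityZ3.Theorems

namespace FiveUpSet

open Finset

variable {γ : Type} [DecidableEq γ] [Fintype γ]

omit [DecidableEq γ] [Fintype γ] in
/-- The empty family of the cube is (trivially) an up-set. [this work] -/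
theorem isUpperSet_empty : IsUpperSet ((∅ : Finset (Finset γ)) : Set (Finset γ)) := by
  rw [coe_empty]; exact _root_.isUpperSet_empty

/-- **`TRI_W(2) ≥ 0` on the stratum `F ∅ = G ∅ = ∅`, pair form.**  For up-sets `P`, `A, B ⊆ F₁`, `C, D ⊆ G₁` of a finite cube,
`0 ≤ triWOne c P ∅ F₁ ∅ G₁ + triWOne c P A B C D` (`c` = complementation): the outer thin-edge functional of `(∅ ⊆ F₁; ∅ ⊆ G₁)` pays for the
inner functional of the (in general non-nested, oppositely tilted) pair `(A, B; C, D)`.  Eleven Kleitman / five-up-set instances plus a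
`6⁴`-case pointwise remainder (see the module docstring). [this work] -/
theorem inner_pair_le_of_bot_empty (P A B F₁ C D G₁ : Finset (Finset γ)) (hP : IsUpperSet (P : Set (Finset γ)))
    (hA : IsUpperSet (A : Set (Finset γ))) (hB : IsUpperSet (B : Set (Finset γ))) (hF₁ : IsUpperSet (F₁ : Set (Finset γ)))
    (hC : IsUpperSet (C : Set (Finset γ))) (hD : IsUpperSet (D : Set (Finset γ))) (hG₁ : IsUpperSet (G₁ : Set (Finset γ)))
    (hA1 : A ⊆ F₁) (hB1 : B ⊆ F₁) (hC1 : C ⊆ G₁) (hD1 : D ⊆ G₁) :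
    0 ≤ LatticeFiveUpSet.triWOne (complEquiv γ) P ∅ F₁ ∅ G₁ + LatticeFiveUpSet.triWOne (complEquiv γ) P A B C D := by
  -- the two thin-edge functionals, written out
  have e0 : LatticeFiveUpSet.triWOne (complEquiv γ) P ∅ F₁ ∅ G₁
      = 2 * ((P ∩ F₁ ∩ G₁).card : ℤ) - ((P ∩ refl F₁ ∩ refl G₁).card : ℤ) := by
    unfold LatticeFiveUpSet.triWOne
    simp [image_complEquiv]
  have e1 : LatticeFiveUpSet.triWOne (complEquiv γ) P A B C D
      = 2 * (((P ∩ A ∩ C).card : ℤ) + ((P ∩ B ∩ D).card : ℤ))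
        - (((P ∩ refl A ∩ D).card : ℤ) + ((P ∩ refl B ∩ C).card : ℤ))
        - (((P ∩ A ∩ refl D).card : ℤ) + ((P ∩ B ∩ refl C).card : ℤ))
        - (((P ∩ refl A ∩ refl C).card : ℤ) + ((P ∩ refl B ∩ refl D).card : ℤ))
        + (((P ∩ refl A ∩ refl D).card : ℤ) + ((P ∩ refl B ∩ refl C).card : ℤ)) := by
    unfold LatticeFiveUpSet.triWOne
    simp only [image_complEquiv]
  rw [e0, e1]
  -- up-set bookkeeping
  have hAB : IsUpperSet ((A ∩ B : Finset (Finset γ)) : Set (Finset γ)) := by rw [coe_inter]; exact hA.inter hB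
  have hCD : IsUpperSet ((C ∩ D : Finset (Finset γ)) : Set (Finset γ)) := by rw [coe_inter]; exact hC.inter hD
  have hAC : IsUpperSet ((A ∩ C : Finset (Finset γ)) : Set (Finset γ)) := by rw [coe_inter]; exact hA.inter hC
  have hBD : IsUpperSet ((B ∩ D : Finset (Finset γ)) : Set (Finset γ)) := by rw [coe_inter]; exact hB.inter hD
  have hPB : IsUpperSet ((P ∩ B : Finset (Finset γ)) : Set (Finset γ)) := by rw [coe_inter]; exact hP.inter hB
  have hPD : IsUpperSet ((P ∩ D : Finset (Finset γ)) : Set (Finset γ)) := by rw [coe_inter]; exact hP.inter hD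
  -- the eleven atoms (ℕ inequalities from the tree), cast to ℤ
  have h1 := card_inter_refl_le (U := P) (X := B ∩ D) hP hBD
  have h2 := card_inter_refl_le (U := P) (X := A ∩ C) hP hAC
  have h3 := fiveUpSetIneq_holds γ P A F₁ C G₁ hP hA hF₁ hC hG₁ hA1 hC1
  have h4 := fiveUpSetIneq_holds γ P B F₁ D G₁ hP hB hF₁ hD hG₁ hB1 hD1
  have h5 := fiveUpSetIneq_holds γ P (A ∩ B) A (C ∩ D) C hP hAB hA hCD hC inter_subset_left inter_subset_left
  have h6 := card_inter_refl_le (U := P ∩ B) (X := C ∩ D) hPB hCD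
  have h7 := card_inter_refl_le (U := P ∩ D) (X := A ∩ B) hPD hAB
  have h8 := fiveUpSetIneq_holds γ P ∅ A D G₁ hP isUpperSet_empty hA hD hG₁ (empty_subset _) hD1
  have h9 := fiveUpSetIneq_holds γ P ∅ B C G₁ hP isUpperSet_empty hB hC hG₁ (empty_subset _) hC1
  have h10 := fiveUpSetIneq_holds γ P ∅ C B F₁ hP isUpperSet_empty hC hB hF₁ (empty_subset _) hB1
  have h11 := fiveUpSetIneq_holds γ P ∅ D A F₁ hP isUpperSet_empty hD hA hF₁ (empty_subset _) hA1
  have h1' : 0 ≤ ((P ∩ (B ∩ D)).card : ℤ) - ((P ∩ refl (B ∩ D)).card : ℤ) := by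
    have := h1; omega
  have h2' : 0 ≤ ((P ∩ (A ∩ C)).card : ℤ) - ((P ∩ refl (A ∩ C)).card : ℤ) := by
    have := h2; omega
  have h3' : 0 ≤ ((P ∩ F₁ ∩ G₁).card : ℤ) + ((P ∩ A ∩ C).card : ℤ) - ((P ∩ F₁ ∩ refl C).card : ℤ) - ((P ∩ refl A ∩ G₁).card : ℤ) - ((P ∩ refl (F₁ \ A) ∩ refl (G₁ \ C)).card : ℤ) := by
    have := h3; omega
  have h4' : 0 ≤ ((P ∩ F₁ ∩ G₁).card : ℤ) + ((P ∩ B ∩ D).card : ℤ) - ((P ∩ F₁ ∩ refl D).card : ℤ) - ((P ∩ refl B ∩ G₁).card : ℤ) - ((P ∩ refl (F₁ \ B) ∩ refl (G₁ \ D)).card : ℤ) := by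
    have := h4; omega
  have h5' : 0 ≤ ((P ∩ A ∩ C).card : ℤ) + ((P ∩ (A ∩ B) ∩ (C ∩ D)).card : ℤ) - ((P ∩ A ∩ refl ((C ∩ D))).card : ℤ) - ((P ∩ refl ((A ∩ B)) ∩ C).card : ℤ) - ((P ∩ refl (A \ (A ∩ B)) ∩ refl (C \ (C ∩ D))).card : ℤ) := by
    have := h5; omega
  have h6' : 0 ≤ ((P ∩ B ∩ (C ∩ D)).card : ℤ) - ((P ∩ B ∩ refl (C ∩ D)).card : ℤ) := by
    have := h6; omega
  have h7' : 0 ≤ ((P ∩ D ∩ (A ∩ B)).card : ℤ) - ((P ∩ D ∩ refl (A ∩ B)).card : ℤ) := by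
    have := h7; omega
  have h8' : 0 ≤ ((P ∩ A ∩ G₁).card : ℤ) + ((P ∩ ∅ ∩ D).card : ℤ) - ((P ∩ A ∩ refl D).card : ℤ) - ((P ∩ refl ∅ ∩ G₁).card : ℤ) - ((P ∩ refl (A \ ∅) ∩ refl (G₁ \ D)).card : ℤ) := by
    have := h8; omega
  have h9' : 0 ≤ ((P ∩ B ∩ G₁).card : ℤ) + ((P ∩ ∅ ∩ C).card : ℤ) - ((P ∩ B ∩ refl C).card : ℤ) - ((P ∩ refl ∅ ∩ G₁).card : ℤ) - ((P ∩ refl (B \ ∅) ∩ refl (G₁ \ C)).card : ℤ) := by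
    have := h9; omega
  have h10' : 0 ≤ ((P ∩ C ∩ F₁).card : ℤ) + ((P ∩ ∅ ∩ B).card : ℤ) - ((P ∩ C ∩ refl B).card : ℤ) - ((P ∩ refl ∅ ∩ F₁).card : ℤ) - ((P ∩ refl (C \ ∅) ∩ refl (F₁ \ B)).card : ℤ) := by
    have := h10; omega
  have h11' : 0 ≤ ((P ∩ D ∩ F₁).card : ℤ) + ((P ∩ ∅ ∩ A).card : ℤ) - ((P ∩ D ∩ refl A).card : ℤ) - ((P ∩ refl ∅ ∩ F₁).card : ℤ) - ((P ∩ refl (D \ ∅) ∩ refl (F₁ \ A)).card : ℤ) := by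
    have := h11; omega
  -- the pointwise remainder: 4·(goal) − Σ coefficient·(atom slack) ≥ 0, point by point of P
  have hR : 0 ≤ 8 * ((P ∩ F₁ ∩ G₁).card : ℤ) - 4 * ((P ∩ refl F₁ ∩ refl G₁).card : ℤ) + 8 * ((P ∩ A ∩ C).card : ℤ) + 8 * ((P ∩ B ∩ D).card : ℤ) - 4 * ((P ∩ refl A ∩ D).card : ℤ) - 4 * ((P ∩ refl B ∩ C).card : ℤ) - 4 * ((P ∩ A ∩ refl D).card : ℤ) - 4 * ((P ∩ B ∩ refl C).card : ℤ) - 4 * ((P ∩ refl A ∩ refl C).card : ℤ) - 4 * ((P ∩ refl B ∩ refl D).card : ℤ) + 4 * ((P ∩ refl A ∩ refl D).card : ℤ) + 4 * ((P ∩ refl B ∩ refl C).card : ℤ) - 3 * ((P ∩ (B ∩ D)).card : ℤ) + 3 * ((P ∩ refl (B ∩ D)).card : ℤ) - ((P ∩ (A ∩ C)).card : ℤ) + ((P ∩ refl (A ∩ C)).card : ℤ) - 3 * ((P ∩ F₁ ∩ G₁).card : ℤ) - 3 * ((P ∩ A ∩ C).card : ℤ) + 3 * ((P ∩ F₁ ∩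 refl C).card : ℤ) + 3 * ((P ∩ refl A ∩ G₁).card : ℤ) + 3 * ((P ∩ refl (F₁ \ A) ∩ refl (G₁ \ C)).card : ℤ) - ((P ∩ F₁ ∩ G₁).card : ℤ) - ((P ∩ B ∩ D).card : ℤ) + ((P ∩ F₁ ∩ refl D).card : ℤ) + ((P ∩ refl B ∩ G₁).card : ℤ) + ((P ∩ refl (F₁ \ B) ∩ refl (G₁ \ D)).card : ℤ) - ((P ∩ A ∩ C).card : ℤ) - ((P ∩ (A ∩ B) ∩ (C ∩ D)).card : ℤ) + ((P ∩ A ∩ refl ((C ∩ D))).card : ℤ) + ((P ∩ refl ((A ∩ B)) ∩ C).card : ℤ) + ((P ∩ refl (A \ (A ∩ B)) ∩ refl (C \ (C ∩ D))).card : ℤ) - ((P ∩ B ∩ (C ∩ D)).card : ℤ) + ((P ∩ B ∩ refl (C ∩ D)).card : ℤ) - ((P ∩ D ∩ (A ∩ B)).card : ℤ) + ((P ∩ D ∩ refl (A ∩ B)).card : ℤ) - 3 * ((P ∩ A ∩ G₁).card : ℤ) - 3 * ((P ∩ ∅ ∩ D).card : ℤ) + 3 * ((P ∩ A ∩ refl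 D).card : ℤ) + 3 * ((P ∩ refl ∅ ∩ G₁).card : ℤ) + 3 * ((P ∩ refl (A \ ∅) ∩ refl (G₁ \ D)).card : ℤ) - ((P ∩ B ∩ G₁).card : ℤ) - ((P ∩ ∅ ∩ C).card : ℤ) + ((P ∩ B ∩ refl C).card : ℤ) + ((P ∩ refl ∅ ∩ G₁).card : ℤ) + ((P ∩ refl (B \ ∅) ∩ refl (G₁ \ C)).card : ℤ) - 3 * ((P ∩ C ∩ F₁).card : ℤ) - 3 * ((P ∩ ∅ ∩ B).card : ℤ) + 3 * ((P ∩ C ∩ refl B).card : ℤ) + 3 * ((P ∩ refl ∅ ∩ F₁).card : ℤ) + 3 * ((P ∩ refl (C \ ∅) ∩ refl (F₁ \ B)).card : ℤ) - ((P ∩ D ∩ F₁).card : ℤ) - ((P ∩ ∅ ∩ A).card : ℤ) + ((P ∩ D ∩ refl A).card : ℤ) + ((P ∩ refl ∅ ∩ F₁).card : ℤ) + ((P ∩ refl (D \ ∅) ∩ refl (F₁ \ A)).card : ℤ) := by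
    rw [card_inter_inter_eq_sum P (F₁) (G₁),
      card_inter_inter_eq_sum P (refl F₁) (refl G₁),
      card_inter_inter_eq_sum P (A) (C),
      card_inter_inter_eq_sum P (B) (D),
      card_inter_inter_eq_sum P (refl A) (D),
      card_inter_inter_eq_sum P (refl B) (C),
      card_inter_inter_eq_sum P (A) (refl D),
      card_inter_inter_eq_sum P (B) (refl C),
      card_inter_inter_eq_sum P (refl A) (refl C),
      card_inter_inter_eq_sum P (refl B) (refl D),
      card_inter_inter_eq_sum P (refl A) (refl D),
      card_inter_inter_eq_sum P (refl B) (refl C),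
      card_inter_eq_sum P ((B ∩ D)),
      card_inter_eq_sum P (refl (B ∩ D)),
      card_inter_eq_sum P ((A ∩ C)),
      card_inter_eq_sum P (refl (A ∩ C)),
      card_inter_inter_eq_sum P (F₁) (refl C),
      card_inter_inter_eq_sum P (refl A) (G₁),
      card_inter_inter_eq_sum P (refl (F₁ \ A)) (refl (G₁ \ C)),
      card_inter_inter_eq_sum P (F₁) (refl D),
      card_inter_inter_eq_sum P (refl B) (G₁),
      card_inter_inter_eq_sum P (refl (F₁ \ B)) (refl (G₁ \ D)),
      card_inter_inter_eq_sum P ((A ∩ B)) ((C ∩ D)),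
      card_inter_inter_eq_sum P (A) (refl ((C ∩ D))),
      card_inter_inter_eq_sum P (refl ((A ∩ B))) (C),
      card_inter_inter_eq_sum P (refl (A \ (A ∩ B))) (refl (C \ (C ∩ D))),
      card_inter_inter_eq_sum P (B) ((C ∩ D)),
      card_inter_inter_eq_sum P (B) (refl (C ∩ D)),
      card_inter_inter_eq_sum P (D) ((A ∩ B)),
      card_inter_inter_eq_sum P (D) (refl (A ∩ B)),
      card_inter_inter_eq_sum P (A) (G₁),
      card_inter_inter_eq_sum P (∅) (D),
      card_inter_inter_eq_sum P (refl ∅) (G₁),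
      card_inter_inter_eq_sum P (refl (A \ ∅)) (refl (G₁ \ D)),
      card_inter_inter_eq_sum P (B) (G₁),
      card_inter_inter_eq_sum P (∅) (C),
      card_inter_inter_eq_sum P (refl (B \ ∅)) (refl (G₁ \ C)),
      card_inter_inter_eq_sum P (C) (F₁),
      card_inter_inter_eq_sum P (∅) (B),
      card_inter_inter_eq_sum P (C) (refl B),
      card_inter_inter_eq_sum P (refl ∅) (F₁),
      card_inter_inter_eq_sum P (refl (C \ ∅)) (refl (F₁ \ B)),
      card_inter_inter_eq_sum P (D) (F₁),
      card_inter_inter_eq_sum P (∅) (A),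
      card_inter_inter_eq_sum P (D) (refl A),
      card_inter_inter_eq_sum P (refl (D \ ∅)) (refl (F₁ \ A))]
    simp only [mem_inter, mem_refl, mem_sdiff, Finset.notMem_empty, Finset.mul_sum, ← Finset.sum_add_distrib, ← Finset.sum_sub_distrib]
    refine Finset.sum_nonneg (fun w _ => ?_)
    obtain ⟨s₁, -, ap, aq, a1⟩ := diamond_pos (empty_subset A) (empty_subset B) hA1 hB1 w
    obtain ⟨s₂, -, bp, bq, b1⟩ := diamond_pos (empty_subset C) (empty_subset D) hC1 hD1 w
    obtain ⟨s₃, -, cp, cq, c1⟩ := diamond_pos (empty_subset A) (empty_subset B) hA1 hB1 wᶜ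
    obtain ⟨s₄, -, dp, dq, d1⟩ := diamond_pos (empty_subset C) (empty_subset D) hC1 hD1 wᶜ
    simp only [ap, aq, a1, bp, bq, b1, cp, cq, c1, dp, dq, d1]
    clear ap aq a1 bp bq b1 cp cq c1 dp dq d1
    revert s₁ s₂ s₃ s₄
    decide
  linarith [hR, h1', h2', h3', h4', h5', h6', h7', h8', h9', h10', h11']

/-- **STRATUM `F ∅ = G ∅ = ∅` of `TRI_W(2) ≥ 0` (unconditional):** index cube with two atoms `a ≠ b`, up-set `P`, monotone families `F, G`
of up-sets of a finite cube with `F ∅ = ∅` and `G ∅ = ∅` (top values and the four middle up-sets arbitrary): `0 ≤ triW P F G`.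
Pair reduction `LatticeFiveUpSet.triW_nonneg_of_pair_nonneg` + `inner_pair_le_of_bot_empty`. [this work] -/
theorem triW_nonneg_of_bot_empty {β : Type} [DecidableEq β] [Fintype β] {a b : β} (hab : a ≠ b) (hu : (univ : Finset β) = {a, b})
    (P : Finset (Finset γ)) (F G : Finset β → Finset (Finset γ))
    (hP : IsUpperSet (P : Set (Finset γ))) (hF : ∀ x, IsUpperSet (F x : Set (Finset γ))) (hG : ∀ x, IsUpperSet (G x : Set (Finset γ)))
    (hFm : Monotone F) (hGm : Monotone G) (hF0 : F ∅ = ∅) (hG0 : G ∅ = ∅) : 0 ≤ triW P F G := by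
  refine LatticeFiveUpSet.triW_nonneg_of_pair_nonneg hab hu P F G ?_
  rw [hF0, hG0]
  exact inner_pair_le_of_bot_empty P (F {a}) (F {b}) (F univ) (G {a}) (G {b}) (G univ) hP (hF {a}) (hF {b}) (hF univ)
    (hG {a}) (hG {b}) (hG univ) (hFm (subset_univ _)) (hFm (subset_univ _)) (hGm (subset_univ _)) (hGm (subset_univ _))

end FiveUpSet

end Summit.CriticalPhenomena.PercolationContinuityZ3.Theorems
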